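import Summits.ResolutionOfSingularities.ResolutionOfSingularities.Theorems.RisoStrataRisoCentresResolvePlumbing

/-!
# Route RisoStrata — crux `RisoCentresResolve` (stmt-ResolutionOfSingularities-18546), line `Sketch`:
# COLLAPSE of the cut alphabet (all letters give the same centre when the cut holds everywhere)

If the cut predicate `P B m d` holds at EVERY singular maximal ideal `m` of `B` for EVERY letter
`d`, then the centre `risoCen P B d` is the intersection of all singular maximal ideals — the
ideal of the reduced singular locus of a Jacobson ring — for every `d` (`risoCen_eq_of_collapse`),
so the blow-up charts (`risoStep_eq_of_collapse`), the admissibility of denominators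
(`risoValid_iff_of_collapse`) and, when this holds for every subalgebra of `K`, the whole tower
(`risoStage_eq_of_collapse`) do not depend on the schedule: every schedule of length `≥ t` acts up
to stage `t` as the constant top word.

For the route's cut `¬ Rtd B m (d + 1)` the hypothesis is `¬ Rtd B m 1` at every singular maximal
ideal (`rcr_collapse_route`, the registered form; monotonicity of `Rtd` in `r`). By
`…PCuspFamily.lean` / `…PCuspCentre.lean` this is exactly what happens along purely inseparable
singular families in characteristic `p` (CHARP-ALPHABET.md): there the crux IS the question
whether iterated blow-up of the reduced singular locus uniformizes every valuation
(SURFACE-PROBER.md). Generic in `P`; no definitions, no named facts.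
-/

set_option linter.dupNamespace false -- mandated namespace of this single-conjunct summit

namespace Summit.ResolutionOfSingularities.ResolutionOfSingularities.Theorems

section Collapse

variable {k K : Type} [Field k] [Field K] [Algebra k K]

/-- Centres of two cut predicates / letters agree as soon as the predicates agree at every
singular maximal ideal. [folklore] -/
theorem risoCen_eq_of_forall_iff (P P' : ∀ B : Subalgebra k K, Ideal ↥B → ℕ → Prop)
    (B : Subalgebra k K) (d d' : ℕ)
    (h : ∀ (m : Ideal ↥B) (hm : m.IsMaximal),
      ¬ IsRegularLocalRing (Localization (@Ideal.primeCompl ↥B _ m hm.isPrime)) →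
        (P B m d ↔ P' B m d')) :
    risoCen P B d = risoCen P' B d' := by
  unfold risoCen
  have hS : {m : Ideal ↥B | ∃ hm : m.IsMaximal,
      ¬ IsRegularLocalRing (Localization (@Ideal.primeCompl ↥B _ m hm.isPrime)) ∧ P B m d} =
      {m : Ideal ↥B | ∃ hm : m.IsMaximal,
      ¬ IsRegularLocalRing (Localization (@Ideal.primeCompl ↥B _ m hm.isPrime)) ∧ P' B m d'} := by
    ext m
    simp only [Set.mem_setOf_eq]
    constructor
    · rintro ⟨hm, hreg, hP⟩
      exact ⟨hm, hreg, (h m hm hreg).1 hP⟩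
    · rintro ⟨hm, hreg, hP⟩
      exact ⟨hm, hreg, (h m hm hreg).2 hP⟩
  rw [hS]

/-- **Collapse of the centres.** If the cut holds at every singular maximal ideal for every
letter, the centre does not depend on the letter. [folklore] -/
theorem risoCen_eq_of_collapse (P : ∀ B : Subalgebra k K, Ideal ↥B → ℕ → Prop)
    (B : Subalgebra k K)
    (hP : ∀ (m : Ideal ↥B) (hm : m.IsMaximal),
      ¬ IsRegularLocalRing (Localization (@Ideal.primeCompl ↥B _ m hm.isPrime)) → ∀ d, P B m d)
    (d d' : ℕ) : risoCen P B d = risoCen P B d' :=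
  risoCen_eq_of_forall_iff P P B d d' fun m hm hreg =>
    ⟨fun _ => hP m hm hreg d', fun _ => hP m hm hreg d⟩

/-- Collapse of the blow-up charts. [folklore] -/
theorem risoStep_eq_of_collapse (P : ∀ B : Subalgebra k K, Ideal ↥B → ℕ → Prop)
    (B : Subalgebra k K)
    (hP : ∀ (m : Ideal ↥B) (hm : m.IsMaximal),
      ¬ IsRegularLocalRing (Localization (@Ideal.primeCompl ↥B _ m hm.isPrime)) → ∀ d, P B m d)
    (d d' : ℕ) (xt : K) : risoStep P B d xt = risoStep P B d' xt := by
  unfold risoStep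
  rw [risoCen_eq_of_collapse P B hP d d']

/-- Collapse of admissibility of denominators. [folklore] -/
theorem risoValid_iff_of_collapse (P : ∀ B : Subalgebra k K, Ideal ↥B → ℕ → Prop)
    (O : ValuationSubring K) (B : Subalgebra k K)
    (hP : ∀ (m : Ideal ↥B) (hm : m.IsMaximal),
      ¬ IsRegularLocalRing (Localization (@Ideal.primeCompl ↥B _ m hm.isPrime)) → ∀ d, P B m d)
    (d d' : ℕ) (xt : K) : risoValid P O B d xt ↔ risoValid P O B d' xt := by
  unfold risoValid
  rw [risoCen_eq_of_collapse P B hP d d']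

/-- **Collapse of the tower.** If the cut holds at every singular maximal ideal of every
subalgebra of `K` for every letter, two schedules define the same stages up to any stage `t`
not exceeding their lengths. [folklore] -/
theorem risoStage_eq_of_collapse (P : ∀ B : Subalgebra k K, Ideal ↥B → ℕ → Prop)
    (hP : ∀ (B : Subalgebra k K) (m : Ideal ↥B) (hm : m.IsMaximal),
      ¬ IsRegularLocalRing (Localization (@Ideal.primeCompl ↥B _ m hm.isPrime)) → ∀ d, P B m d)
    (B₀ : Subalgebra k K) (sched sched' : List ℕ) (x : ℕ → K) {t : ℕ}
    (ht : t ≤ sched.length) (ht' : t ≤ sched'.length) :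
    risoStage P B₀ sched x t = risoStage P B₀ sched' x t := by
  induction t with
  | zero => rw [risoStage_zero, risoStage_zero]
  | succ t ih =>
    have h1 : t < sched.length := Nat.lt_of_succ_le ht
    have h2 : t < sched'.length := Nat.lt_of_succ_le ht'
    rw [risoStage_succ P B₀ sched x h1, risoStage_succ P B₀ sched' x h2, ih h1.le h2.le,
      risoStep_eq_of_collapse P _ (hP _) (sched.getD t 0) (sched'.getD t 0)]

end Collapse

/-! ## The route's cut `¬ Rtd B m (d + 1)` -/

section Route

/-- **Collapse for the route's cut.** If every singular maximal ideal of every `k`-subalgebra of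
`K` has typed `rtd = 0` (`¬ Rtd B m 1`, as along purely inseparable singular families,
`pcusp_not_rtd_one`), then the riso tower of the route does not depend on the schedule: any two
schedules give the same stage `t ≤` both lengths, for every start and every choice of
denominators. [folklore] -/
theorem rcr_collapse_route : ∀ {k K : Type} [Field k] [Field K] [Algebra k K], (∀ (B : Subalgebra k K) (m : Ideal ↥B) (hm : m.IsMaximal), ¬ IsRegularLocalRing (Localization (@Ideal.primeCompl ↥B _ m hm.isPrime)) → ¬ ∃ (n : ℕ) (g : Fin n → ↥B), (∀ i, g i ∈ m) ∧ Algebra.adjoin k (Set.range fun i => (g i : K)) = B ∧ ∃ W : Submodule k (Fin n → k), 1 ≤ Module.finrank k ↥W ∧ ∃ φ : {α : ↥B →ₐ[k] HahnSeries ℚ k // ∀ b ∈ m, 0 < (α b).orderTop} → (Fin n → HahnSeries ℚ k), (∀ a b : {α : ↥B →ₐ[k] HahnSeries ℚ k // ∀ b ∈ m, 0 < (α b).orderTop}, a ≠ b → ∃ j, ∀ i, (a.1 (g j) - b.1 (g j)).orderTop < ((φ a i - φ b i) - (a.1 (g i) - b.1 (g i))).orderTop) ∧ (∀ a i, 0 <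 (φ a i).orderTop) ∧ (∀ a, ∀ w : Fin n → HahnSeries ℚ k, (∀ i, 0 < (w i).orderTop) → w ∈ Submodule.span (HahnSeries ℚ k) ((fun u : Fin n → k => fun i => HahnSeries.C (u i)) '' (W : Set (Fin n → k))) → ∃ b, φ b = φ a + w)) → ∀ (B₀ : Subalgebra k K) (sched sched' : List ℕ) (x : ℕ → K) (t : ℕ), t ≤ sched.length → t ≤ sched'.length → risoStage (fun (B : Subalgebra k K) (m : Ideal ↥B) (d : ℕ) => ¬ ∃ (n : ℕ) (g : Fin n → ↥B), (∀ i, g i ∈ m) ∧ Algebra.adjoin k (Set.range fun i => (g i : K)) = B ∧ ∃ W : Submodule k (Fin n → k), d + 1 ≤ Module.finrank k ↥W ∧ ∃ φ : {α : ↥B →ₐ[k] HahnSeries ℚ k // ∀ b ∈ m, 0 < (α b).orderTop} → (Fin n → HahnSeries ℚ k), (∀ a b : {α : ↥B →ₐ[k] HahnSeries ℚ k // ∀ b ∈ m, 0 < (α b).orderTop}, a ≠ b → ∃ j, ∀ i, (a.1 (g j) - b.1 (g j)).orderTop < ((φ a i - φ b i) - (a.1 (g i) - b.1 (g i))).orderTop)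 ∧ (∀ a i, 0 < (φ a i).orderTop) ∧ (∀ a, ∀ w : Fin n → HahnSeries ℚ k, (∀ i, 0 < (w i).orderTop) → w ∈ Submodule.span (HahnSeries ℚ k) ((fun u : Fin n → k => fun i => HahnSeries.C (u i)) '' (W : Set (Fin n → k))) → ∃ b, φ b = φ a + w)) B₀ sched x t = risoStage (fun (B : Subalgebra k K) (m : Ideal ↥B) (d : ℕ) => ¬ ∃ (n : ℕ) (g : Fin n → ↥B), (∀ i, g i ∈ m) ∧ Algebra.adjoin k (Set.range fun i => (g i : K)) = B ∧ ∃ W : Submodule k (Fin n → k), d + 1 ≤ Module.finrank k ↥W ∧ ∃ φ : {α : ↥B →ₐ[k] HahnSeries ℚ k // ∀ b ∈ m, 0 < (α b).orderTop} → (Fin n → HahnSeries ℚ k), (∀ a b : {α : ↥B →ₐ[k] HahnSeries ℚ k // ∀ b ∈ m, 0 < (α b).orderTop}, a ≠ b → ∃ j, ∀ i, (a.1 (g j) - b.1 (g j)).orderTop < ((φ a i - φ b i) - (a.1 (g i) - b.1 (g i))).orderTop) ∧ (∀ a i, 0 < (φ a i).orderTop) ∧ (∀ a, ∀ w : Fin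 n → HahnSeries ℚ k, (∀ i, 0 < (w i).orderTop) → w ∈ Submodule.span (HahnSeries ℚ k) ((fun u : Fin n → k => fun i => HahnSeries.C (u i)) '' (W : Set (Fin n → k))) → ∃ b, φ b = φ a + w)) B₀ sched' x t := by
  intro k K _ _ _ hK B₀ sched sched' x t ht ht'
  refine risoStage_eq_of_collapse _ (fun B m hm hreg d => ?_) B₀ sched sched' x ht ht'
  -- monotonicity of `Rtd` in `r`: a witness for `d + 1` is a witness for `1`
  rintro ⟨n, g, hg, hgen, W, hW, φ, h1, h2, h3⟩
  exact hK B m hm hreg ⟨n, g, hg, hgen, W, le_trans (Nat.le_add_left 1 d) hW, φ, h1, h2, h3⟩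

end Route

end Summit.ResolutionOfSingularities.ResolutionOfSingularities.Theorems
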